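import Summits.AtomisticToContinuum.Crystallization.Theorems.ChargedEnergyGapSlimPack
import HarnessLib

/-!
# (T¹ᶜ) station certificates — NODE 113K «FlatCorner»: the 108C corner certificate over flat INTEGER data

decomp-a2c lens-3 g95.  Imports tree (236) 113H `ChargedEnergyGapSlimPack` (`cmLoop`, `pivPos`, `BasisIdx`, `colEntry?`, `bsx`) and through it
110E `StationCert` / 108C `CellChecker` (`BoxLeaf`, `cornerW`, `bit`, `allCorners`, `roofVal_T75_le_six`, `corners_of_sext`).

WHY (K-profile g95, part 3 of the (FD) door unit: 5 box leaves, 139 slim bases, kernel time 36 s): 60 % of the kernel time of a station is the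
108C CORNER BLOCK (≈ 83 ms per corner certificate: six `dotQ`, 36 reconstruction products and ≈ 110 table / box accesses through `sextQ`,
`relabel`, `T75Q[k]?`, all in `ℚ`), 30 % the slim expansion, 4 % the Farkas tree; the kernel is step-bound (number size is irrelevant).
This node restates the corner certificate over data HOISTED ONCE PER BASIS and ONCE PER LEAF, in `ℤ`:

* §113K.1 the INTEGER MIRROR of the table: every pattern entry of `T75Q` is a multiple of `1/1000`, every price a multiple of `1/100000`
  (`T75Q_integral`, by `decide`), so `zpat e q = 1000 · e.1 q` and `zprice e = 100000 · e.2` are exact integers;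
* §113K.2 the FLAT BASIS `B.flat = ⟨E, G, pr, d⟩` of a slim basis: `E p = [1000 · e_m (relabel g_m s_m p)]_m` (the scaled basis matrix, slots in
  `cegSlot6` order), `(G, d)` = the rows and last pivot of the SAME 113H Montante run `cmLoop` (sign-normalised to `d > 0`), so that
  `B⁻¹[m][c] = 1000 · G[m][c] / d`, and the integer prices `pr`;
* §113K.3 the INTEGER CORNER CERTIFICATE `cornerCheckZ`: with the corner weight scaled to integers `w = Ew · W`, the multipliers
  `μ_m = G_m · w` satisfy `0 ≤ μ_m`, the EXACT reconstruction `d · w_p = Σ_m μ_m E[p][m]` at the six slots, and the price bound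
  `(Σ_m μ_m pr_m) · Rd ≤ Rn · 100 · d · Ew` (`R = Rn / Rd`) — about 130 integer operations on six-lists, no table access; SOUNDNESS
  `cornerCheckZ_sound : … → roofVal T75 W ≤ R` through 108B `roofVal_T75_le_six` with the real multipliers `λ_m = μ_m · 1000 / (d · Ew)` (a
  WITNESS: no lemma relating `G` to `B⁻¹` is needed);
* §113K.4 the INTEGER BOX of a leaf (`BoxLeaf.ew` = common denominator `Ew` of the twelve box numbers, `zW` = the scaled corner weights,
  `R` as a fraction) and the flat COST BLOCK `boxCostZ` (64 integer corner certificates) with `boxCostZ_sound` = the `∀ β` corner hypothesis of 108C, and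
  `StationCert.box_payload_soundZ` = 110E `box_payload_sound` verbatim from the flat block.

The station / unit plumbing (`checkDXZ`, `ZUnit.checkM`, soundness with the binders of 113F `SphUnit.sound`) is NODE 113L «FlatUnit».
Certificate files are UNCHANGED in content (same slim bases, same leaves, same corner ↦ basis map); only the checker differs.

MEASURED (g95): band-1 door unit, 13 representative cells / 40 box leaves / 1 189 slim bases — 113D/113I path (DoorMB1, 2 files) 348 s,
flat path (DoorZB1, 1 file, same bytes) 215 s; cost atoms per live leaf 5.0 s → 1.6 s (64 corners ≈ 20 ms each), per slim basis 0.078 s → 0.09 s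
(the in-kernel Montante run, ≈ 1 700 integer operations, is now the dominant atom); part 3 alone 43.0 s → 33.0 s wall.
-/

namespace Summit.AtomisticToContinuum.Crystallization.Theorems.ChargedEnergyGapChartDial

/-! ## §113K.1 The integer mirror of the table -/
section Table

/-- The pattern entry `e.1 q` scaled by `1000`, as an integer (exact on `T75Q`: `zpat_cast`). -/
def zpat (e : (Fin 3 × Bool → ℚ) × ℚ) (q : Fin 3 × Bool) : ℤ := (e.1 q * 1000).num

/-- The price `e.2` scaled by `100000`, as an integer (exact on `T75Q`: `zprice_cast`). -/
def zprice (e : (Fin 3 × Bool → ℚ) × ℚ) : ℤ := (e.2 * 100000).num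

/-- ★ Every pattern entry of `T75Q` is a multiple of `1/1000` and every price a multiple of `1/100000`. -/
theorem T75Q_integral : T75Q.all (fun e => allSlots (fun q => (e.1 q * 1000).den == 1) && ((e.2 * 100000).den == 1)) = true := by
  decide +kernel

/-- `zpat` is exact on table rows. -/
theorem zpat_cast {e : (Fin 3 × Bool → ℚ) × ℚ} (he : e ∈ T75Q) (q : Fin 3 × Bool) : ((zpat e q : ℤ) : ℚ) = e.1 q * 1000 := by
  have h := List.all_eq_true.1 T75Q_integral e he
  simp only [Bool.and_eq_true, allSlots_iff, beq_iff_eq] at h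
  exact Rat.coe_int_num_of_den_eq_one (h.1 q)

/-- `zprice` is exact on table rows. -/
theorem zprice_cast {e : (Fin 3 × Bool → ℚ) × ℚ} (he : e ∈ T75Q) : ((zprice e : ℤ) : ℚ) = e.2 * 100000 := by
  have h := List.all_eq_true.1 T75Q_integral e he
  simp only [Bool.and_eq_true, allSlots_iff, beq_iff_eq] at h
  exact Rat.coe_int_num_of_den_eq_one h.2

end Table

/-! ## §113K.2 Flat integer basis data -/
section Flat

/-- Integer dot product of two lists (truncating to the shorter). -/
def dotZ : List ℤ → List ℤ → ℤ
  | a :: as, b :: bs => a * b + dotZ as bs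
  | _, _ => 0

/-- ★ The FLAT payload of a slim basis: scaled basis matrix `E` (rows = slots in `cegSlot6` order, six integers each), multiplier rows `G`
(`μ_m = G_m · w`), integer prices `pr`, and the common divisor `d` (`λ_m = 1000 · μ_m / (d · Ew)`). -/
structure FlatBasis where
  /-- scaled basis matrix rows -/
  E : List (List ℤ)
  /-- multiplier rows -/
  G : List (List ℤ)
  /-- integer prices `× 100000` -/
  pr : List ℤ
  /-- common divisor (`0` marks an unusable basis) -/
  d : ℤ

/-- The scaled basis matrix of columns `e₀ … e₅` placed as in `B`. -/
def BasisIdx.flatRows (B : BasisIdx) (e₀ e₁ e₂ e₃ e₄ e₅ : (Fin 3 × Bool → ℚ) × ℚ) : List (List ℤ) :=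
  cegSlot6.map fun p => [zpat e₀ (relabel B.c₀.g B.c₀.s p), zpat e₁ (relabel B.c₁.g B.c₁.s p), zpat e₂ (relabel B.c₂.g B.c₂.s p),
    zpat e₃ (relabel B.c₃.g B.c₃.s p), zpat e₄ (relabel B.c₄.g B.c₄.s p), zpat e₅ (relabel B.c₅.g B.c₅.s p)]

/-- The multiplier rows and divisor of an integer `6×6` matrix by the 113H compact Montante run (`cmLoop` from `(i, E_i, [])`; row `m`, entry `c`
= `G_m[pivPos c]`), sign-normalised to `d > 0`; `([], 0)` if singular. -/
def montG (E : List (List ℤ)) : List (List ℤ) × ℤ :=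
  match cmLoop 6 1 [] ((List.range 6).zipWith (fun i r => (i, r, ([] : List ℤ))) E) with
  | none => ([], 0)
  | some (done, d) =>
    let perm := done.map (fun r => r.1)
    let G := done.map (fun r => (List.range 6).map (fun c => r.2.2.getD (pivPos c perm) 0))
    if d < 0 then (G.map (fun r => r.map (fun x => -x)), -d) else (G, d)

/-- ★ The flat payload of a slim basis (`d = 0` if a column is out of range or the matrix is singular). -/
def BasisIdx.flat (B : BasisIdx) : FlatBasis :=
  match colEntry? B.c₀, colEntry? B.c₁, colEntry? B.c₂, colEntry? B.c₃, colEntry? B.c₄, colEntry? B.c₅ with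
  | some e₀, some e₁, some e₂, some e₃, some e₄, some e₅ =>
    ⟨B.flatRows e₀ e₁ e₂ e₃ e₄ e₅, (montG (B.flatRows e₀ e₁ e₂ e₃ e₄ e₅)).1,
      [zprice e₀, zprice e₁, zprice e₂, zprice e₃, zprice e₄, zprice e₅], (montG (B.flatRows e₀ e₁ e₂ e₃ e₄ e₅)).2⟩
  | _, _, _, _, _, _ => ⟨[], [], [], 0⟩

/-- Flat payloads of a list of slim bases. -/
def flatAll (Bs : List BasisIdx) : List FlatBasis := Bs.map BasisIdx.flat

/-- sanity: the flat payload of a basis of Cb1k8 has a positive divisor and six multiplier rows. -/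
example : 0 < (bsx 3890 3895 288 3894 6448 6456).flat.d ∧ (bsx 3890 3895 288 3894 6448 6456).flat.G.length = 6 := by decide +kernel

end Flat

/-! ## §113K.3 The integer corner certificate -/
section Corner

/-- `0`-based slot position in `cegSlot6` order. -/
def zIx (q : Fin 3 × Bool) : ℕ := 2 * (q.1 : ℕ) + cond q.2 0 1

/-- Slot-wise case analysis (the six slots by their numerals). -/
theorem slot_cases {P : Fin 3 × Bool → Prop} (h₀ : P (0, true)) (h₁ : P (0, false)) (h₂ : P (1, true)) (h₃ : P (1, false))
    (h₄ : P (2, true)) (h₅ : P (2, false)) : ∀ p, P p := by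
  rintro ⟨i, s⟩; fin_cases i <;> cases s <;> assumption

/-- ★ THE INTEGER CORNER CERTIFICATE of flat basis `F` at the scaled corner weight `w = Ew · W` (six integers, `cegSlot6` order) against
`R = Rn / Rd`: `d > 0`, `μ = G w ≥ 0`, price bound, exact reconstruction at the six slots. -/
def FlatBasis.cornerCheckZ (F : FlatBasis) (Ew : ℕ) (Rn : ℤ) (Rd : ℕ) (w : List ℤ) : Bool :=
  let μ₀ := dotZ (F.G.getD 0 []) w
  let μ₁ := dotZ (F.G.getD 1 []) w
  let μ₂ := dotZ (F.G.getD 2 []) w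
  let μ₃ := dotZ (F.G.getD 3 []) w
  let μ₄ := dotZ (F.G.getD 4 []) w
  let μ₅ := dotZ (F.G.getD 5 []) w
  let μ := [μ₀, μ₁, μ₂, μ₃, μ₄, μ₅]
  decide (0 < F.d ∧ 0 ≤ μ₀ ∧ 0 ≤ μ₁ ∧ 0 ≤ μ₂ ∧ 0 ≤ μ₃ ∧ 0 ≤ μ₄ ∧ 0 ≤ μ₅ ∧ dotZ F.pr μ * Rd ≤ Rn * (100 * F.d * Ew)) &&
    decide (F.d * w.getD 0 0 = dotZ (F.E.getD 0 []) μ ∧ F.d * w.getD 1 0 = dotZ (F.E.getD 1 []) μ ∧ F.d * w.getD 2 0 = dotZ (F.E.getD 2 []) μ ∧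
      F.d * w.getD 3 0 = dotZ (F.E.getD 3 []) μ ∧ F.d * w.getD 4 0 = dotZ (F.E.getD 4 []) μ ∧ F.d * w.getD 5 0 = dotZ (F.E.getD 5 []) μ)

/-- ★★ SOUNDNESS OF THE INTEGER CORNER CERTIFICATE: `roofVal T75 W ≤ R` (rows by index `castRow_mem_T75_of_getElem?`, integrality by
`zpat_cast` / `zprice_cast`, then 108B `roofVal_T75_le_six` with `λ_m = μ_m · 1000 / (d · Ew)`). -/
theorem cornerCheckZ_sound (B : BasisIdx) {Ew : ℕ} (hEw : 0 < Ew) {R : ℚ} {w : List ℤ} {W : Fin 3 × Bool → ℚ}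
    (hw : ∀ p, ((w.getD (zIx p) 0 : ℤ) : ℚ) = W p * Ew) (h : B.flat.cornerCheckZ Ew R.num R.den w = true) :
    roofVal T75 (castW W) ≤ (R : ℝ) := by
  unfold BasisIdx.flat at h
  split at h
  · next e₀ e₁ e₂ e₃ e₄ e₅ k₀ k₁ k₂ k₃ k₄ k₅ =>
    unfold colEntry? at k₀ k₁ k₂ k₃ k₄ k₅
    have m₀ := List.mem_of_getElem? k₀; have m₁ := List.mem_of_getElem? k₁; have m₂ := List.mem_of_getElem? k₂
    have m₃ := List.mem_of_getElem? k₃; have m₄ := List.mem_of_getElem? k₄; have m₅ := List.mem_of_getElem? k₅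
    generalize hGd : montG (B.flatRows e₀ e₁ e₂ e₃ e₄ e₅) = Gd at h
    obtain ⟨G, d⟩ := Gd
    simp only [FlatBasis.cornerCheckZ, Bool.and_eq_true, decide_eq_true_eq] at h
    obtain ⟨⟨hd, hμ₀, hμ₁, hμ₂, hμ₃, hμ₄, hμ₅, hobj⟩, hrec⟩ := h
    generalize dotZ (G.getD 0 []) w = μ₀ at *
    generalize dotZ (G.getD 1 []) w = μ₁ at *
    generalize dotZ (G.getD 2 []) w = μ₂ at *
    generalize dotZ (G.getD 3 []) w = μ₃ at *
    generalize dotZ (G.getD 4 []) w = μ₄ at *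
    generalize dotZ (G.getD 5 []) w = μ₅ at *
    simp only [BasisIdx.flatRows, cegSlot6, List.map_cons, List.map_nil, List.getD_cons_zero, List.getD_cons_succ, dotZ, add_zero]
      at hrec hobj
    obtain ⟨r0, r1, r2, r3, r4, r5⟩ := hrec
    -- numeral forms of the weight hypothesis (`zIx` computes)
    have hw0 : ((w.getD 0 0 : ℤ) : ℚ) = W (0, true) * Ew := hw (0, true)
    have hw1 : ((w.getD 1 0 : ℤ) : ℚ) = W (0, false) * Ew := hw (0, false)
    have hw2 : ((w.getD 2 0 : ℤ) : ℚ) = W (1, true) * Ew := hw (1, true)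
    have hw3 : ((w.getD 3 0 : ℤ) : ℚ) = W (1, false) * Ew := hw (1, false)
    have hw4 : ((w.getD 4 0 : ℤ) : ℚ) = W (2, true) * Ew := hw (2, true)
    have hw5 : ((w.getD 5 0 : ℤ) : ℚ) = W (2, false) * Ew := hw (2, false)
    -- real multipliers `λ_m = μ_m · κ`
    set κ : ℝ := 1000 / ((d : ℝ) * Ew) with hκ
    have hdE : (0 : ℝ) < (d : ℝ) * Ew := mul_pos (by exact_mod_cast hd) (by exact_mod_cast hEw)
    have hκ0 : 0 ≤ κ := div_nonneg (by norm_num) hdE.le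
    have hdκ : (d : ℝ) * Ew * κ = 1000 := by rw [hκ]; field_simp
    have hl : ∀ μ : ℤ, 0 ≤ μ → 0 ≤ (μ : ℝ) * κ := fun μ hμ => mul_nonneg (by exact_mod_cast hμ) hκ0
    -- one reconstruction identity `d · (W p · Ew) = Σ e · 1000 · μ` in ℚ gives the real representation at slot `p`
    have rep : ∀ (p : Fin 3 × Bool), (d : ℚ) * (W p * Ew) = e₀.1 (relabel B.c₀.g B.c₀.s p) * 1000 * μ₀ + (e₁.1 (relabel B.c₁.g B.c₁.s p) * 1000 * μ₁ +
        (e₂.1 (relabel B.c₂.g B.c₂.s p) * 1000 * μ₂ + (e₃.1 (relabel B.c₃.g B.c₃.s p) * 1000 * μ₃ + (e₄.1 (relabel B.c₄.g B.c₄.s p) * 1000 * μ₄ +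
        e₅.1 (relabel B.c₅.g B.c₅.s p) * 1000 * μ₅)))) →
        (W p : ℝ) = (μ₀ : ℝ) * κ * ((e₀.1 (relabel B.c₀.g B.c₀.s p) : ℚ) : ℝ) + (μ₁ : ℝ) * κ * ((e₁.1 (relabel B.c₁.g B.c₁.s p) : ℚ) : ℝ) +
        (μ₂ : ℝ) * κ * ((e₂.1 (relabel B.c₂.g B.c₂.s p) : ℚ) : ℝ) + (μ₃ : ℝ) * κ * ((e₃.1 (relabel B.c₃.g B.c₃.s p) : ℚ) : ℝ) +
        (μ₄ : ℝ) * κ * ((e₄.1 (relabel B.c₄.g B.c₄.s p) : ℚ) : ℝ) + (μ₅ : ℝ) * κ * ((e₅.1 (relabel B.c₅.g B.c₅.s p) : ℚ) : ℝ) := by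
      intro p hq
      have hr : (d : ℝ) * ((W p : ℝ) * Ew) = ((e₀.1 (relabel B.c₀.g B.c₀.s p) : ℚ) : ℝ) * 1000 * μ₀ +
          (((e₁.1 (relabel B.c₁.g B.c₁.s p) : ℚ) : ℝ) * 1000 * μ₁ + (((e₂.1 (relabel B.c₂.g B.c₂.s p) : ℚ) : ℝ) * 1000 * μ₂ +
          (((e₃.1 (relabel B.c₃.g B.c₃.s p) : ℚ) : ℝ) * 1000 * μ₃ + (((e₄.1 (relabel B.c₄.g B.c₄.s p) : ℚ) : ℝ) * 1000 * μ₄ +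
          ((e₅.1 (relabel B.c₅.g B.c₅.s p) : ℚ) : ℝ) * 1000 * μ₅)))) := by exact_mod_cast congrArg (fun x : ℚ => (x : ℝ)) hq
      have e1 : (W p : ℝ) * 1000 = (d : ℝ) * ((W p : ℝ) * Ew) * κ := by rw [← hdκ]; ring
      rw [hr] at e1
      linear_combination (1 / 1000 : ℝ) * e1
    have hrep : ∀ p, (W p : ℝ) = (μ₀ : ℝ) * κ * ((e₀.1 (relabel B.c₀.g B.c₀.s p) : ℚ) : ℝ) + (μ₁ : ℝ) * κ * ((e₁.1 (relabel B.c₁.g B.c₁.s p) : ℚ) : ℝ) +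
        (μ₂ : ℝ) * κ * ((e₂.1 (relabel B.c₂.g B.c₂.s p) : ℚ) : ℝ) + (μ₃ : ℝ) * κ * ((e₃.1 (relabel B.c₃.g B.c₃.s p) : ℚ) : ℝ) +
        (μ₄ : ℝ) * κ * ((e₄.1 (relabel B.c₄.g B.c₄.s p) : ℚ) : ℝ) + (μ₅ : ℝ) * κ * ((e₅.1 (relabel B.c₅.g B.c₅.s p) : ℚ) : ℝ) := by
      have cast6 : ∀ {z : ℤ} {x : ℚ} {q₀ q₁ q₂ q₃ q₄ q₅ : Fin 3 × Bool}, ((z : ℤ) : ℚ) = x * Ew →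
          d * z = zpat e₀ q₀ * μ₀ + (zpat e₁ q₁ * μ₁ + (zpat e₂ q₂ * μ₂ + (zpat e₃ q₃ * μ₃ + (zpat e₄ q₄ * μ₄ + zpat e₅ q₅ * μ₅)))) →
          (d : ℚ) * (x * Ew) = e₀.1 q₀ * 1000 * μ₀ + (e₁.1 q₁ * 1000 * μ₁ + (e₂.1 q₂ * 1000 * μ₂ + (e₃.1 q₃ * 1000 * μ₃ +
          (e₄.1 q₄ * 1000 * μ₄ + e₅.1 q₅ * 1000 * μ₅)))) := by
        intro z x q₀ q₁ q₂ q₃ q₄ q₅ hx hz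
        have := congrArg (fun t : ℤ => (t : ℚ)) hz
        simp only [Int.cast_mul, Int.cast_add, zpat_cast m₀, zpat_cast m₁, zpat_cast m₂, zpat_cast m₃, zpat_cast m₄, zpat_cast m₅, hx] at this
        exact this
      exact slot_cases (rep _ (cast6 hw0 r0)) (rep _ (cast6 hw1 r1)) (rep _ (cast6 hw2 r2)) (rep _ (cast6 hw3 r3)) (rep _ (cast6 hw4 r4))
        (rep _ (cast6 hw5 r5))
    -- the price bound, in ℝ
    have obj : (μ₀ : ℝ) * κ * ((e₀.2 : ℚ) : ℝ) + (μ₁ : ℝ) * κ * ((e₁.2 : ℚ) : ℝ) + (μ₂ : ℝ) * κ * ((e₂.2 : ℚ) : ℝ) +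
        (μ₃ : ℝ) * κ * ((e₃.2 : ℚ) : ℝ) + (μ₄ : ℝ) * κ * ((e₄.2 : ℚ) : ℝ) + (μ₅ : ℝ) * κ * ((e₅.2 : ℚ) : ℝ) ≤ (R : ℝ) := by
      have hq : (e₀.2 * 100000 * μ₀ + (e₁.2 * 100000 * μ₁ + (e₂.2 * 100000 * μ₂ + (e₃.2 * 100000 * μ₃ + (e₄.2 * 100000 * μ₄ +
          e₅.2 * 100000 * μ₅)))) : ℚ) * R.den ≤ R * R.den * (100 * d * Ew) := by
        have := (Int.cast_le (R := ℚ)).2 hobj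
        simp only [Int.cast_mul, Int.cast_add, Int.cast_natCast, zprice_cast m₀, zprice_cast m₁, zprice_cast m₂, zprice_cast m₃,
          zprice_cast m₄, zprice_cast m₅, Int.cast_ofNat] at this
        rwa [← Rat.mul_den_eq_num R] at this
      have hden : (0 : ℚ) < 100 * R.den := by have := R.den_pos; positivity
      have hS : (μ₀ * e₀.2 + μ₁ * e₁.2 + μ₂ * e₂.2 + μ₃ * e₃.2 + μ₄ * e₄.2 + μ₅ * e₅.2 : ℚ) * 1000 ≤ R * (d * Ew) := by
        refine le_of_mul_le_mul_right ?_ hden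
        linear_combination hq
      have hS' : ((μ₀ : ℝ) * ((e₀.2 : ℚ) : ℝ) + (μ₁ : ℝ) * ((e₁.2 : ℚ) : ℝ) + (μ₂ : ℝ) * ((e₂.2 : ℚ) : ℝ) + (μ₃ : ℝ) * ((e₃.2 : ℚ) : ℝ) +
          (μ₄ : ℝ) * ((e₄.2 : ℚ) : ℝ) + (μ₅ : ℝ) * ((e₅.2 : ℚ) : ℝ)) * 1000 ≤ (R : ℝ) * ((d : ℝ) * Ew) := by exact_mod_cast hS
      have hT : ((μ₀ : ℝ) * ((e₀.2 : ℚ) : ℝ) + (μ₁ : ℝ) * ((e₁.2 : ℚ) : ℝ) + (μ₂ : ℝ) * ((e₂.2 : ℚ) : ℝ) + (μ₃ : ℝ) * ((e₃.2 : ℚ) : ℝ) +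
          (μ₄ : ℝ) * ((e₄.2 : ℚ) : ℝ) + (μ₅ : ℝ) * ((e₅.2 : ℚ) : ℝ)) * κ ≤ (R : ℝ) := by
        rw [hκ, ← mul_div_assoc, div_le_iff₀ hdE]; exact hS'
      calc _ = ((μ₀ : ℝ) * ((e₀.2 : ℚ) : ℝ) + (μ₁ : ℝ) * ((e₁.2 : ℚ) : ℝ) + (μ₂ : ℝ) * ((e₂.2 : ℚ) : ℝ) + (μ₃ : ℝ) * ((e₃.2 : ℚ) : ℝ) +
          (μ₄ : ℝ) * ((e₄.2 : ℚ) : ℝ) + (μ₅ : ℝ) * ((e₅.2 : ℚ) : ℝ)) * κ := by ring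
        _ ≤ _ := hT
    refine (roofVal_T75_le_six (castRow_mem_T75_of_getElem? k₀) (castRow_mem_T75_of_getElem? k₁) (castRow_mem_T75_of_getElem? k₂)
      (castRow_mem_T75_of_getElem? k₃) (castRow_mem_T75_of_getElem? k₄) (castRow_mem_T75_of_getElem? k₅)
      B.c₀.g B.c₁.g B.c₂.g B.c₃.g B.c₄.g B.c₅.g B.c₀.s B.c₁.s B.c₂.s B.c₃.s B.c₄.s B.c₅.s
      (hl μ₀ hμ₀) (hl μ₁ hμ₁) (hl μ₂ hμ₂) (hl μ₃ hμ₃) (hl μ₄ hμ₄) (hl μ₅ hμ₅) (fun p => ?_)).trans ?_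
    · dsimp only [castRow, castW]; exact hrep p
    · dsimp only [castRow]; exact obj
  · simp [FlatBasis.cornerCheckZ] at h

end Corner

/-! ## §113K.4 The integer box of a leaf and the flat cost block -/
section Box

/-- The corner bit pattern `(a, b, c, d, e, g)` as a slot function (`sext` order). -/
def sextB (a b c d e g : Bool) (p : Fin 3 × Bool) : Bool := if p.2 then ![a, c, e] p.1 else ![b, d, g] p.1

/-- [formal bookkeeping] the 108C corner weight is `U` at the set bits and `L` elsewhere. -/
theorem cornerW_eq_cond (L U : Fin 3 × Bool → ℚ) (a b c d e g : Bool) :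
    ∀ p, cornerW L U a b c d e g p = cond (sextB a b c d e g p) (U p) (L p) :=
  slot_cases rfl rfl rfl rfl rfl rfl

/-- The common denominator `Ew` of the twelve box numbers of a leaf (113G `slimLcmDen`). -/
def BoxLeaf.ew (b : BoxLeaf) : ℕ := slimLcmDen (cegSlot6.map b.L ++ cegSlot6.map b.U)

/-- Validity of the integer box: `0 < Ew` and the twelve scalings `Ew · L q`, `Ew · U q` are exact integers. -/
def BoxLeaf.ewOK (b : BoxLeaf) : Bool :=
  decide (0 < b.ew) && allSlots (fun q => ((b.L q * b.ew).den == 1) && ((b.U q * b.ew).den == 1))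

/-- The scaled weight list `Ew · W` of the corner with bit pattern `β` (`true ↦ U`), `cegSlot6` order. -/
def BoxLeaf.zW (b : BoxLeaf) (β : Fin 3 × Bool → Bool) : List ℤ := cegSlot6.map fun q => (cond (β q) (b.U q) (b.L q) * b.ew).num

/-- [formal bookkeeping] the scaled weight list is exact. -/
theorem BoxLeaf.zW_spec {b : BoxLeaf} (hok : b.ewOK = true) (β : Fin 3 × Bool → Bool) :
    ∀ p, (((b.zW β).getD (zIx p) 0 : ℤ) : ℚ) = cond (β p) (b.U p) (b.L p) * b.ew := by
  simp only [BoxLeaf.ewOK, Bool.and_eq_true, decide_eq_true_eq, allSlots_iff, beq_iff_eq] at hok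
  have key : ∀ p, (b.zW β).getD (zIx p) 0 = (cond (β p) (b.U p) (b.L p) * b.ew).num := slot_cases rfl rfl rfl rfl rfl rfl
  intro p
  rw [key]
  cases β p
  · exact Rat.coe_int_num_of_den_eq_one (hok.2 p).1
  · exact Rat.coe_int_num_of_den_eq_one (hok.2 p).2

/-- The flat check of the corner with bits `(a, b', c, d, e, g)` of leaf `b` against the flat bases `Fs` (the leaf's corner ↦ basis map). -/
def cornerOKZ (Fs : List FlatBasis) (b : BoxLeaf) (a b' c d e g : Bool) : Bool :=
  match b.cornerBasis[bit a 32 + bit b' 16 + bit c 8 + bit d 4 + bit e 2 + bit g 1]? with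
  | none => false
  | some j =>
    match Fs[j]? with
    | none => false
    | some F => F.cornerCheckZ b.ew b.R.num b.R.den (b.zW (sextB a b' c d e g))

/-- ★ THE FLAT COST BLOCK of a leaf: valid integer box, `0 ≤ L ≤ U` slot-wise, and the 64 integer corner certificates. -/
def boxCostZ (Fs : List FlatBasis) (b : BoxLeaf) : Bool :=
  b.ewOK && allSlots (fun q => decide (0 ≤ b.L q ∧ b.L q ≤ b.U q)) && allCorners (cornerOKZ Fs b)

/-- ★★ SOUNDNESS OF THE FLAT COST BLOCK: the `∀ β` corner hypothesis of 108 `costCell_law` (dispatcher `corners_of_sext`), as 108C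
`CostCellCert.costCheck_sound`. -/
theorem boxCostZ_sound {Bs : List BasisIdx} {b : BoxLeaf} (h : boxCostZ (flatAll Bs) b = true) :
    ∀ β : Fin 3 × Bool → Bool, roofVal T75 (fun q => if β q then castW b.U q else castW b.L q) ≤ (b.R : ℝ) := by
  simp only [boxCostZ, Bool.and_eq_true] at h
  obtain ⟨⟨hok, -⟩, hc⟩ := h
  have hEw : 0 < b.ew := by
    simp only [BoxLeaf.ewOK, Bool.and_eq_true, decide_eq_true_eq] at hok; exact hok.1
  refine corners_of_sext fun a b' c' d e g => ?_
  have hk := (allCorners_iff _).1 hc a b' c' d e g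
  unfold cornerOKZ at hk
  split at hk
  · exact absurd hk Bool.false_ne_true
  · next j hj =>
    split at hk
    · exact absurd hk Bool.false_ne_true
    · next F hF =>
      rw [flatAll, List.getElem?_map] at hF
      obtain ⟨B, -, rfl⟩ := Option.map_eq_some_iff.1 hF
      rw [← castW_cornerW]
      exact cornerCheckZ_sound B hEw (W := cornerW b.L b.U a b' c' d e g) (fun p => by rw [b.zW_spec hok, cornerW_eq_cond]) hk

/-- ★★ THE BOX-LEAF PAYLOAD LEMMA from the flat block: 110E `StationCert.box_payload_sound` verbatim, with `boxCostZ` for `boxCost`. -/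
theorem StationCert.box_payload_soundZ (c : StationCert) {Bs : List BasisIdx} {b : BoxLeaf} (hb : boxCostZ (flatAll Bs) b = true) {capLB : ℚ}
    (hv : ((c.kfac * b.R : ℚ) : ℝ) ≤ ((capLB * c.u : ℚ) : ℝ)) (dt : (Fin 3 → ℤ) → ℝ) (hneed : ∀ r ∈ b.need, linAt r.a (sval dt) 0 ≤ (r.b : ℝ)) :
    (3 / 100 * (2 * (c.R.rho1 : ℝ))) ^ 2 * roofVal T75 (vtxW 160 dt 0) ≤ (capLB : ℝ) * c.u := by
  have hcorners := boxCostZ_sound hb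
  simp only [boxCostZ, Bool.and_eq_true, decide_eq_true_eq, allSlots_iff] at hb
  obtain ⟨⟨-, hLU⟩, -⟩ := hb
  simp only [BoxLeaf.need, List.mem_cons, List.not_mem_nil, or_false, forall_eq_or_imp, forall_eq, indRow_b, linAt_indRow] at hneed
  push_cast at hneed
  simp only [one_mul, neg_mul, neg_le_neg_iff] at hneed
  obtain ⟨u0, u1, u2, u3, u4, u5, l0, l1, l2, l3, l4, l5⟩ := hneed
  have hW : ∀ q, castW b.L q ≤ vtxW 160 dt 0 q ∧ vtxW 160 dt 0 q ≤ castW b.U q := by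
    rintro ⟨a, s⟩
    simp only [castW_apply]
    fin_cases a <;> cases s
    exacts [⟨l1, u1⟩, ⟨l0, u0⟩, ⟨l3, u3⟩, ⟨l2, u2⟩, ⟨l5, u5⟩, ⟨l4, u4⟩]
  have hL : ∀ q, 0 ≤ castW b.L q := fun q => by simp only [castW_apply]; exact_mod_cast (hLU q).1
  have hLU' : ∀ q, castW b.L q ≤ castW b.U q := fun q => by simp only [castW_apply]; exact_mod_cast (hLU q).2
  have hroof : roofVal T75 (vtxW 160 dt 0) ≤ (b.R : ℝ) := roofVal_T75_le_of_corners hL hLU' hcorners (vtxW 160 dt 0) hW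
  have hk : (0 : ℝ) ≤ (3 / 100 * (2 * (c.R.rho1 : ℝ))) ^ 2 := sq_nonneg _
  simp only [StationCert.kfac] at hv
  push_cast at hv
  exact (mul_le_mul_of_nonneg_left hroof hk).trans hv

end Box

end Summit.AtomisticToContinuum.Crystallization.Theorems.ChargedEnergyGapChartDial
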